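import Summits.HubbardSuperconductivity.HubbardSuperconductivity.Theorems.FunctionFieldCertificateWindowInfraredBoundEtaGapDomination
import Summits.HubbardSuperconductivity.HubbardSuperconductivity.Theorems.WindowGap.Negative.FreeWindowCalibration
import Summits.HubbardSuperconductivity.HubbardSuperconductivity.Theorems.WindowInfraredBound.Negative.ParsevalCeiling
import Literature.MathematicalPhysics.QuantumLattice.FreeFermionSectorEnergyDeviation
import Literature.MathematicalPhysics.QuantumLattice.TorusShellCountUniform

/-!
# Crux `WindowInfraredBound` (stmt-HubbardSuperconductivity-1089) — the free point `U = 0`: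
# the crux body HOLDS (flat law `C ε² L²`) in EVERY sector and for EVERY ground state,
# degenerate open shells included (SKELETON — lead c7; stubs `stub_*` are delegated)

Calibration R4 of `Cruxes/WindowInfraredBound/STRATEGY-CENSUS.md` §5(iv)/§7 (`FreeWindowBoundAllGroundStates`):
`Disproof.lean` §4.3 checked the window functional numerically along ONE Slater ground state, and
`WindowGap.Negative.FreeWindowCalibration` bounds only the ground-projection AVERAGE; here the bound is
proved for every vector of the (possibly exponentially degenerate) free sector ground space.

Basis-free mechanism (no Wick theorem, no trial state, no plane-wave Slater basis):
* `stub_freeTransferVanishes` — for a sector ground state `ψ` of `H₀ = hubbardTorus 2 L 1 0 = Σ ε_L(k) n_{kσ}`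
  and `ε_L(k) < ε_L(k')`: `c†_{kσ} c_{k'σ} ψ = 0` (the transfer is an exact LOWERING eigen-operator of `H₀`
  preserving the sector; one-sided KKT lever `eucNorm_mulVec_le_of_approxLowering` with zero remainder);
* `stub_freeSeaStructure` — transfer-vanishing + `Σ_k n_{kσ} ψ = ν ψ` force `n_{kσ}ψ = ψ` on the
  `#{ε ≤ ε_k} ≤ ν` levels and `n_{kσ}ψ = 0` on the `ν ≤ #{ε < ε_k}` levels (counting); the undecided
  "shell" lies in ONE level set, of size `≤ 2L` (`free_levelSet_card_le`, from `card_torusShell_le_sqrt`);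
* `stub_freeOrthogonalModeSum`, `stub_freeTriangleModeSum` — for the pair modes
  `B_m(k) = c_{(m−k)↓}c_{k↑}` of `Δ_d(m) = −Σ_k A_m(k) B_m(k)` (`pairFieldAt_eq_neg_sum_smul_pairModeAt`,
  `|A_m(k)|² ≤ 50`): modes through a sharp level are pairwise orthogonal on `ψ` (Pythagoras, `≤ 50·#K`),
  shell×shell modes are at most `2L` (triangle inequality), modes through an empty level vanish;
hence `‖Δ_d(m)ψ‖² ≤ 450 L²`, i.e. `S_ψ(m) ≤ 450` at EVERY momentum, and over the crux's window
`T_ε(ψ) ≤ 450 · #{m : |q_m| ≤ ε} ≤ 113 ε² L²` (`card_window_le`).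

Sources: J. Bardeen, L. N. Cooper, J. R. Schrieffer, Phys. Rev. 108 (1957) 1175, §II; C. N. Yang,
Rev. Mod. Phys. 34 (1962) 694, §3; E. H. Lieb, M. Loss, *Analysis* (2001) Thm 1.14 (bathtub);
L. Pitaevskii, S. Stringari, J. Low Temp. Phys. 85 (1991) 377. Folklore finite-dimensional statements;
no definition and no named fact is introduced.
-/

noncomputable section

-- the mandated namespace repeats `HubbardSuperconductivity` (single-problem summit, D-0017)
set_option linter.dupNamespace false

namespace Summit.HubbardSuperconductivity.HubbardSuperconductivity.Theorems.WindowInfraredBound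

open Matrix Finset
open Literature.Probability.LatticeModels Literature.MathematicalPhysics.QuantumLattice
open scoped ComplexOrder ComplexConjugate

/-! ## §0 The stubs (delegated; each lands in its own `--supports` file) -/

/-- **Stub S2 — transfers to lower levels annihilate free sector ground states.** For a ground state `ψ`
of `H₀ = hubbardTorus 2 L 1 0` (`L ≥ 3`) in the sector `(N, S^z = M)` and levels `ε_L(k) < ε_L(k')`:
`c†_{kσ} c_{k'σ} ψ = 0`. Proof: `[H₀, c†_{kσ}c_{k'σ}] = (ε_L(k) − ε_L(k')) c†_{kσ}c_{k'σ}`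
(`hubbardTorus_zero_eq_sum_momentumNumber` and the CAR), the transfer preserves `szSector N M`, so
`eucNorm_mulVec_le_of_approxLowering` with `ω = ε_L(k') − ε_L(k) > 0` and zero remainder gives
`ω ‖c†c ψ‖ ≤ 0`. Lieb–Loss (2001) Thm 1.14. [folklore] -/
theorem stub_freeTransferVanishes : ∀ (L : ℕ) [NeZero L], 3 ≤ L → ∀ (N : ℕ) (M : ℝ)
    (ψ : Fock (Orb (FermionTorus 2 L))), IsGroundStateInSector (hubbardTorus 2 L 1 0) N M ψ →
    ∀ (k k' : TorusSite 2 L) (σ : Fin 2), torusBand L k < torusBand L k' →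
      (momentumCreation k σ * momentumAnnihilation k' σ) *ᵥ ψ = 0 := by
  sorry

/-- **Stub S3 — sharp Fermi sea away from the Fermi level.** If `Σ_k n_{kσ} ψ = ν ψ` and every transfer
to a strictly lower level annihilates `ψ` (`e k < e k' → c†_{kσ}c_{k'σ}ψ = 0`), then the levels with
`#{e ≤ e k} ≤ ν` are filled (`n_{kσ}ψ = ψ`) and those with `ν ≤ #{e < e k}` are empty (`n_{kσ}ψ = 0`)
(counting: `ν‖(1−n_k)ψ‖² ≤ (#{e ≤ e_k} − 1)‖(1−n_k)ψ‖²`, resp. `ν‖n_kψ‖² ≥ (#{e < e_k} + 1)‖n_kψ‖²`).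
Lieb–Loss (2001) Thm 1.14 (bathtub, equality case). [folklore] -/
theorem stub_freeSeaStructure : ∀ (L : ℕ) [NeZero L] (σ : Fin 2) (e : TorusSite 2 L → ℝ) (ν : ℝ)
    (ψ : Fock (Orb (FermionTorus 2 L))),
    (∑ k : TorusSite 2 L, momentumNumber k σ) *ᵥ ψ = (ν : ℂ) • ψ →
    (∀ k k' : TorusSite 2 L, e k < e k' → (momentumCreation k σ * momentumAnnihilation k' σ) *ᵥ ψ = 0) →
    ∀ k : TorusSite 2 L,
      ((((Finset.univ.filter fun k' : TorusSite 2 L => e k' ≤ e k).card : ℕ) : ℝ) ≤ ν →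
          momentumNumber k σ *ᵥ ψ = ψ) ∧
      (ν ≤ (((Finset.univ.filter fun k' : TorusSite 2 L => e k' < e k).card : ℕ) : ℝ) →
          momentumNumber k σ *ᵥ ψ = 0) := by
  sorry

/-- **Stub S4a — pair modes through a sharp level are orthogonal (Pythagoras).** For the pair modes
`B_m(k) = c_{(m−k)↓} c_{k↑}` and a finite set `K` of momenta each of which has `n_{k↑}ψ = ψ` or
`n_{(m−k)↓}ψ = ψ`: the vectors `B_m(k)ψ`, `k ∈ K`, are pairwise orthogonal (insert the sharp occupation,
commute it to the other mode, `n c = 0`), and `‖B_m(k)ψ‖ ≤ ‖ψ‖`, so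
`‖Σ_{k∈K} A(k) B_m(k) ψ‖² ≤ a · #K · ‖ψ‖²` when `|A(k)|² ≤ a`. Bardeen–Cooper–Schrieffer (1957) §II. [folklore] -/
theorem stub_freeOrthogonalModeSum : ∀ (L : ℕ) [NeZero L] (m : TorusSite 2 L) (A : TorusSite 2 L → ℂ)
    (a : ℝ) (K : Finset (TorusSite 2 L)) (ψ : Fock (Orb (FermionTorus 2 L))),
    (∀ k ∈ K, ‖A k‖ ^ 2 ≤ a) →
    (∀ k ∈ K, momentumNumber k 0 *ᵥ ψ = ψ ∨ momentumNumber (m - k) 1 *ᵥ ψ = ψ) →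
    (star ((∑ k ∈ K, A k • (momentumAnnihilation (m - k) 1 * momentumAnnihilation k 0)) *ᵥ ψ) ⬝ᵥ
        ((∑ k ∈ K, A k • (momentumAnnihilation (m - k) 1 * momentumAnnihilation k 0)) *ᵥ ψ)).re ≤
      a * K.card * (star ψ ⬝ᵥ ψ).re := by
  sorry

/-- **Stub S4b — crude triangle bound for a sum of pair modes.** `‖Σ_{k∈K} A(k) B_m(k) ψ‖ ≤ √a · #K · ‖ψ‖`
when `|A(k)|² ≤ a` (`‖c_{kσ}‖ ≤ 1`). [folklore] -/
theorem stub_freeTriangleModeSum : ∀ (L : ℕ) [NeZero L] (m : TorusSite 2 L) (A : TorusSite 2 L → ℂ)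
    (a : ℝ) (K : Finset (TorusSite 2 L)) (ψ : Fock (Orb (FermionTorus 2 L))), 0 ≤ a →
    (∀ k ∈ K, ‖A k‖ ^ 2 ≤ a) →
    eucNorm ((∑ k ∈ K, A k • (momentumAnnihilation (m - k) 1 * momentumAnnihilation k 0)) *ᵥ ψ) ≤
      Real.sqrt a * K.card * eucNorm ψ := by
  sorry

/-! ## §1 Level sets of the band and the two empty-mode vanishings -/

section Kinematics

variable {L : ℕ} [NeZero L]

/-- **A level set of the square-lattice band has at most `2L` points**: `#{k : ε_L(k) = e} ≤ 2L`
(`card_torusShell_le_sqrt` at width `0`: on each row `cos` takes every value at most twice). [folklore] -/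
theorem free_levelSet_card_le (e : ℝ) :
    (((Finset.univ.filter fun k : TorusSite 2 L => torusBand L k = e).card : ℕ) : ℝ) ≤ 2 * L := by
  have h := card_torusShell_le_sqrt (L := L) e 0
  rw [Real.sqrt_zero, zero_mul, zero_add] at h
  have hsub : (Finset.univ.filter fun k : TorusSite 2 L => torusBand L k = e) ⊆
      (Finset.univ.filter fun k : TorusSite 2 L => |torusBand L k - e| ≤ 0) := by
    intro k hk
    simp only [Finset.mem_filter, Finset.mem_univ, true_and] at hk ⊢
    rw [hk, sub_self, abs_zero]
  exact le_trans (by exact_mod_cast Finset.card_le_card hsub) h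

/-- `c_{kσ} ψ = 0` when the mode is empty, `n_{kσ} ψ = 0` (`c n = c`). [folklore] -/
theorem free_momentumAnnihilation_mulVec_eq_zero {k : TorusSite 2 L} {σ : Fin 2}
    {ψ : Fock (Orb (FermionTorus 2 L))} (h : momentumNumber k σ *ᵥ ψ = 0) :
    momentumAnnihilation k σ *ᵥ ψ = 0 := by
  rw [← momentumAnnihilation_mul_momentumNumber_self, ← mulVec_mulVec, h, mulVec_zero]

/-- The pair mode `B_m(k) = c_{(m−k)↓}c_{k↑}` kills `ψ` if either of its modes is empty in `ψ`. [folklore] -/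
theorem free_pairModeAt_mulVec_eq_zero (m k : TorusSite 2 L) {ψ : Fock (Orb (FermionTorus 2 L))}
    (h : momentumNumber k 0 *ᵥ ψ = 0 ∨ momentumNumber (m - k) 1 *ᵥ ψ = 0) :
    (momentumAnnihilation (m - k) 1 * momentumAnnihilation k 0) *ᵥ ψ = 0 := by
  rcases h with h | h
  · rw [← mulVec_mulVec, free_momentumAnnihilation_mulVec_eq_zero h, mulVec_zero]
  · rw [momentumAnnihilation_mul_eq_neg, neg_mulVec, ← mulVec_mulVec,
      free_momentumAnnihilation_mulVec_eq_zero h, mulVec_zero, neg_zero]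

end Kinematics

/-! ## §2 The pair field of a state with a sharp Fermi sea outside a thin shell -/

section ModeBound

variable {L : ℕ} [NeZero L]

/-- **Abstract mode bound.** Let `ψ` have, for each spin, FILLED momenta `F σ` (`n_{kσ}ψ = ψ`) and EMPTY
momenta `E σ` (`n_{kσ}ψ = 0`) whose common complement (the shell) has at most `s` points for spin `↑`.
Then for coefficients `|A(k)|² ≤ a`:
`‖Σ_k A(k) c_{(m−k)↓}c_{k↑} ψ‖ ≤ √a (L + s) ‖ψ‖` — modes through an empty level vanish
(`free_pairModeAt_mulVec_eq_zero`), modes through a filled level are pairwise orthogonal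
(`stub_freeOrthogonalModeSum`, at most `L²` of them), and the shell×shell modes number at most `s`
(`stub_freeTriangleModeSum`). Bardeen–Cooper–Schrieffer (1957) §II. [folklore] -/
theorem free_eucNorm_modeSum_mulVec_le (m : TorusSite 2 L) (A : TorusSite 2 L → ℂ) {a : ℝ} (ha : 0 ≤ a)
    (hA : ∀ k, ‖A k‖ ^ 2 ≤ a) (F E : Fin 2 → Finset (TorusSite 2 L)) {s : ℝ}
    (ψ : Fock (Orb (FermionTorus 2 L)))
    (hF : ∀ σ, ∀ k ∈ F σ, momentumNumber k σ *ᵥ ψ = ψ)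
    (hE : ∀ σ, ∀ k ∈ E σ, momentumNumber k σ *ᵥ ψ = 0)
    (hs : ((((F 0 ∪ E 0)ᶜ).card : ℕ) : ℝ) ≤ s) :
    eucNorm ((∑ k : TorusSite 2 L, A k • (momentumAnnihilation (m - k) 1 * momentumAnnihilation k 0)) *ᵥ ψ) ≤
      Real.sqrt a * ((L : ℝ) + s) * eucNorm ψ := by
  classical
  set B : TorusSite 2 L → Matrix (Finset (Orb (FermionTorus 2 L))) (Finset (Orb (FermionTorus 2 L))) ℂ :=
    fun k => momentumAnnihilation (m - k) 1 * momentumAnnihilation k 0 with hB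
  -- the three classes of momenta
  set pE : TorusSite 2 L → Prop := fun k => k ∈ E 0 ∨ m - k ∈ E 1 with hpE
  set pF : TorusSite 2 L → Prop := fun k => k ∈ F 0 ∨ m - k ∈ F 1 with hpF
  set KE : Finset (TorusSite 2 L) := Finset.univ.filter fun k => pE k with hKE
  set KF : Finset (TorusSite 2 L) := (Finset.univ.filter fun k => ¬ pE k).filter fun k => pF k with hKF
  set KS : Finset (TorusSite 2 L) := (Finset.univ.filter fun k => ¬ pE k).filter fun k => ¬ pF k with hKS
  -- splitting the sum
  have hsplit : ∑ k : TorusSite 2 L, A k • B k =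
      ∑ k ∈ KE, A k • B k + (∑ k ∈ KF, A k • B k + ∑ k ∈ KS, A k • B k) := by
    rw [hKF, hKS, Finset.sum_filter_add_sum_filter_not, hKE, Finset.sum_filter_add_sum_filter_not]
  -- the empty class contributes nothing
  have hE0 : (∑ k ∈ KE, A k • B k) *ᵥ ψ = 0 := by
    rw [Matrix.sum_mulVec]
    refine Finset.sum_eq_zero fun k hk => ?_
    rw [hKE, Finset.mem_filter] at hk
    rw [smul_mulVec, hB]
    rw [free_pairModeAt_mulVec_eq_zero m k (hk.2.imp (hE 0 k) (hE 1 (m - k))), smul_zero]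
  -- the filled class: Pythagoras
  have hF1 : eucNorm ((∑ k ∈ KF, A k • B k) *ᵥ ψ) ≤ Real.sqrt a * L * eucNorm ψ := by
    have h1 := stub_freeOrthogonalModeSum L m A a KF ψ (fun k _ => hA k) (fun k hk => by
      rw [hKF, Finset.mem_filter] at hk
      exact hk.2.imp (hF 0 k) (hF 1 (m - k)))
    have hcard : (KF.card : ℝ) ≤ (L : ℝ) ^ 2 := by
      have := Finset.card_le_univ KF
      rw [card_torusSite_two] at this
      exact_mod_cast this
    have h2 : eucNorm ((∑ k ∈ KF, A k • B k) *ᵥ ψ) ^ 2 ≤ (Real.sqrt a * L * eucNorm ψ) ^ 2 := by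
      rw [eucNorm_sq, mul_pow, mul_pow, Real.sq_sqrt ha, eucNorm_sq]
      refine h1.trans ?_
      have h0 : 0 ≤ (star ψ ⬝ᵥ ψ).re := by rw [← eucNorm_sq]; exact sq_nonneg _
      have : a * KF.card * (star ψ ⬝ᵥ ψ).re ≤ a * (L : ℝ) ^ 2 * (star ψ ⬝ᵥ ψ).re :=
        mul_le_mul_of_nonneg_right (mul_le_mul_of_nonneg_left hcard ha) h0
      linarith
    exact (pow_le_pow_iff_left₀ (eucNorm_nonneg _)
      (mul_nonneg (mul_nonneg (Real.sqrt_nonneg _) (Nat.cast_nonneg _)) (eucNorm_nonneg _)) two_ne_zero).1 h2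
  -- the shell class: at most `s` modes, triangle inequality
  have hS1 : eucNorm ((∑ k ∈ KS, A k • B k) *ᵥ ψ) ≤ Real.sqrt a * s * eucNorm ψ := by
    have h1 := stub_freeTriangleModeSum L m A a KS ψ ha (fun k _ => hA k)
    have hsub : KS ⊆ (F 0 ∪ E 0)ᶜ := by
      intro k hk
      rw [hKS, Finset.mem_filter, Finset.mem_filter] at hk
      rw [Finset.mem_compl, Finset.mem_union, not_or]
      exact ⟨fun h => hk.2 (Or.inl h), fun h => hk.1.2 (Or.inl h)⟩
    have hcard : (KS.card : ℝ) ≤ s := le_trans (by exact_mod_cast Finset.card_le_card hsub) hs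
    refine h1.trans ?_
    have : Real.sqrt a * KS.card * eucNorm ψ ≤ Real.sqrt a * s * eucNorm ψ :=
      mul_le_mul_of_nonneg_right (mul_le_mul_of_nonneg_left hcard (Real.sqrt_nonneg a)) (eucNorm_nonneg ψ)
    exact this
  -- assemble
  calc eucNorm ((∑ k : TorusSite 2 L, A k • B k) *ᵥ ψ)
      = eucNorm ((∑ k ∈ KF, A k • B k) *ᵥ ψ + (∑ k ∈ KS, A k • B k) *ᵥ ψ) := by
        rw [hsplit, add_mulVec, hE0, zero_add, add_mulVec]
    _ ≤ eucNorm ((∑ k ∈ KF, A k • B k) *ᵥ ψ) + eucNorm ((∑ k ∈ KS, A k • B k) *ᵥ ψ) := eucNorm_add_le _ _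
    _ ≤ Real.sqrt a * L * eucNorm ψ + Real.sqrt a * s * eucNorm ψ := add_le_add hF1 hS1
    _ = Real.sqrt a * ((L : ℝ) + s) * eucNorm ψ := by ring

end ModeBound

/-! ## §3 Free sector ground states: fillings, sharp Fermi seas, thin shells -/

section FermiSea

variable {L : ℕ} [NeZero L]

/-- The spin-resolved particle numbers in momentum space as combinations of the charges:
`Σ_k n_{k↑} = ½ N̂ + S^z`, `Σ_k n_{k↓} = ½ N̂ − S^z` (Parseval per spin, `sum_momentumNumber_eq_sum_numberOp`).
Tasaki (2020) §9.3. [folklore] -/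
theorem free_sum_momentumNumber_eq (σ : Fin 2) :
    ∑ k : TorusSite 2 L, momentumNumber k σ =
      (1 / 2 : ℂ) • (totalNumber : Matrix (Finset (Orb (FermionTorus 2 L))) (Finset (Orb (FermionTorus 2 L))) ℂ) +
        (if σ = 0 then (1 : ℂ) else -1) • HubbardWave0.spinZ := by
  rw [sum_momentumNumber_eq_sum_numberOp, totalNumber_eq_spinWeightedNumber, spinZ_eq_spinWeightedNumber]
  simp only [spinWeightedNumber, Fin.sum_univ_two, Fin.isValue, Matrix.cons_val_zero, Matrix.cons_val_one,
    Finset.smul_sum, ← Finset.sum_add_distrib]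
  refine Finset.sum_congr rfl fun x _ => ?_
  fin_cases σ
  · simp only [Fin.zero_eta, Fin.isValue, ↓reduceIte, one_smul, smul_add, smul_smul]
    module
  · simp only [Fin.mk_one, Fin.isValue, one_ne_zero, ↓reduceIte, one_smul, smul_add, smul_smul, neg_smul]
    module

/-- **Fillings.** On the joint sector `(N, S^z = M)`: `Σ_k n_{k↑} ψ = (N/2 + M) ψ` and
`Σ_k n_{k↓} ψ = (N/2 − M) ψ`. Lieb, PRL 62 (1989) 1201. [folklore] -/
theorem free_sum_momentumNumber_mulVec_of_mem_szSector {N : ℕ} {M : ℝ}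
    {ψ : Fock (Orb (FermionTorus 2 L))} (hψ : ψ ∈ szSector N M) (σ : Fin 2) :
    (∑ k : TorusSite 2 L, momentumNumber k σ) *ᵥ ψ =
      (((N : ℝ) / 2 + (if σ = 0 then M else -M) : ℝ) : ℂ) • ψ := by
  rw [mem_szSector_iff] at hψ
  obtain ⟨hN, hS⟩ := hψ
  replace hN := totalNumber_mulVec_of_isNParticle hN
  rw [free_sum_momentumNumber_eq, add_mulVec, smul_mulVec, smul_mulVec, hN, hS, smul_smul, smul_smul,
    ← add_smul]
  congr 1
  split_ifs <;> push_cast <;> ring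

/-- **Sharp Fermi seas of free sector ground states.** For a ground state `ψ` of `hubbardTorus 2 L 1 0`
(`L ≥ 3`) in the sector `(N, S^z = M)` with fillings `ν_↑ = N/2 + M`, `ν_↓ = N/2 − M`: every level `k` with
`#{ε_L ≤ ε_L(k)} ≤ ν_σ` is filled (`n_{kσ}ψ = ψ`) and every level with `ν_σ ≤ #{ε_L < ε_L(k)}` is empty
(`n_{kσ}ψ = 0`) — whatever the degeneracy of the sector ground space (`stub_freeTransferVanishes` +
`stub_freeSeaStructure`). Lieb–Loss (2001) Thm 1.14. [folklore] -/
theorem free_groundState_seaStructure (hL : 3 ≤ L) {N : ℕ} {M : ℝ} {ψ : Fock (Orb (FermionTorus 2 L))}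
    (hψ : IsGroundStateInSector (hubbardTorus 2 L 1 0) N M ψ) (σ : Fin 2) (k : TorusSite 2 L) :
    ((((Finset.univ.filter fun k' : TorusSite 2 L => torusBand L k' ≤ torusBand L k).card : ℕ) : ℝ) ≤
          (N : ℝ) / 2 + (if σ = 0 then M else -M) → momentumNumber k σ *ᵥ ψ = ψ) ∧
      ((N : ℝ) / 2 + (if σ = 0 then M else -M) ≤
          (((Finset.univ.filter fun k' : TorusSite 2 L => torusBand L k' < torusBand L k).card : ℕ) : ℝ) →
        momentumNumber k σ *ᵥ ψ = 0) :=
  stub_freeSeaStructure L σ (torusBand L) _ ψ (free_sum_momentumNumber_mulVec_of_mem_szSector hψ.1 σ)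
    (fun k₁ k₂ h => stub_freeTransferVanishes L hL N M ψ hψ k₁ k₂ σ h) k

/-- **The undecided shell lies in one level set, hence has at most `2L` points.** For any filling `ν`:
the momenta that are neither forced-filled (`#{ε ≤ ε_k} ≤ ν`) nor forced-empty (`ν ≤ #{ε < ε_k}`) all have
the same band energy, so there are at most `2L` of them (`free_levelSet_card_le`). [folklore] -/
theorem free_shell_card_le (ν : ℝ) :
    (((Finset.univ.filter fun k : TorusSite 2 L =>
        ¬ ((((Finset.univ.filter fun k' : TorusSite 2 L => torusBand L k' ≤ torusBand L k).card : ℕ) : ℝ) ≤ ν) ∧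
        ¬ (ν ≤ (((Finset.univ.filter fun k' : TorusSite 2 L => torusBand L k' < torusBand L k).card : ℕ) : ℝ))).card
        : ℕ) : ℝ) ≤ 2 * L := by
  classical
  set S := Finset.univ.filter fun k : TorusSite 2 L =>
        ¬ ((((Finset.univ.filter fun k' : TorusSite 2 L => torusBand L k' ≤ torusBand L k).card : ℕ) : ℝ) ≤ ν) ∧
        ¬ (ν ≤ (((Finset.univ.filter fun k' : TorusSite 2 L => torusBand L k' < torusBand L k).card : ℕ) : ℝ))
    with hS
  -- comparison of the two counting functions across a strict level gap
  have hmono : ∀ a b : TorusSite 2 L, torusBand L a < torusBand L b →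
      (((Finset.univ.filter fun k' : TorusSite 2 L => torusBand L k' ≤ torusBand L a).card : ℕ) : ℝ) ≤
        (((Finset.univ.filter fun k' : TorusSite 2 L => torusBand L k' < torusBand L b).card : ℕ) : ℝ) := by
    intro a b hab
    exact_mod_cast Finset.card_le_card (fun k' hk' => by
      simp only [Finset.mem_filter, Finset.mem_univ, true_and] at hk' ⊢
      exact lt_of_le_of_lt hk' hab)
  rcases S.eq_empty_or_nonempty with h0 | ⟨k₀, hk₀⟩
  · rw [h0, Finset.card_empty, Nat.cast_zero]; positivity
  · have hsub : S ⊆ Finset.univ.filter fun k : TorusSite 2 L => torusBand L k = torusBand L k₀ := by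
      intro k hk
      rw [hS, Finset.mem_filter] at hk hk₀
      simp only [Finset.mem_filter, Finset.mem_univ, true_and]
      obtain ⟨_, hk1, hk2⟩ := hk
      obtain ⟨_, hl1, hl2⟩ := hk₀
      push Not at hk1 hk2 hl1 hl2
      by_contra hne
      rcases lt_or_gt_of_ne hne with hlt | hgt
      · have := hmono k k₀ hlt; linarith
      · have := hmono k₀ k hgt; linarith
    exact le_trans (by exact_mod_cast Finset.card_le_card hsub) (free_levelSet_card_le (torusBand L k₀))

end FermiSea

/-! ## §4 The `d`-wave pair field of a free sector ground state: `‖Δ_d(m)ψ‖² ≤ 450 L²` -/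

section PairField

variable {L : ℕ} [NeZero L]

open Summit.HubbardSuperconductivity.HubbardSuperconductivity.Theorems.WindowGap.Negative
  (pairFieldAt_eq_neg_sum_smul_pairModeAt normSq_pairModeAtCoeff_dWave_le card_window_le)

/-- **`‖Δ_d(m) ψ‖ ≤ 3√50 · L · ‖ψ‖` for every sector ground state of the free torus and EVERY pair momentum
`m`** (`L ≥ 3`): `Δ_d(m) = −Σ_k A_m(k) c_{(m−k)↓}c_{k↑}` with `|A_m(k)|² ≤ 50`
(`pairFieldAt_eq_neg_sum_smul_pairModeAt`, `normSq_pairModeAtCoeff_dWave_le`), the sharp Fermi seas of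
`free_groundState_seaStructure`, the thin shell of `free_shell_card_le`, and `free_eucNorm_modeSum_mulVec_le`.
Bardeen–Cooper–Schrieffer (1957) §II; Yang (1962) §3. [folklore] -/
theorem free_eucNorm_pairFieldAt_dWave_mulVec_le (hL : 3 ≤ L) {N : ℕ} {M : ℝ}
    {ψ : Fock (Orb (FermionTorus 2 L))} (hψ : IsGroundStateInSector (hubbardTorus 2 L 1 0) N M ψ)
    (m : TorusSite 2 L) :
    eucNorm (pairFieldAt dWaveFormFactor L m *ᵥ ψ) ≤ Real.sqrt 50 * (3 * L) * eucNorm ψ := by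
  classical
  -- fillings and the forced-filled / forced-empty momenta per spin
  set ν : Fin 2 → ℝ := fun σ => (N : ℝ) / 2 + (if σ = 0 then M else -M) with hν
  set F : Fin 2 → Finset (TorusSite 2 L) := fun σ => Finset.univ.filter fun k : TorusSite 2 L =>
      (((Finset.univ.filter fun k' : TorusSite 2 L => torusBand L k' ≤ torusBand L k).card : ℕ) : ℝ) ≤ ν σ
    with hF
  set E : Fin 2 → Finset (TorusSite 2 L) := fun σ => Finset.univ.filter fun k : TorusSite 2 L =>
      ν σ ≤ (((Finset.univ.filter fun k' : TorusSite 2 L => torusBand L k' < torusBand L k).card : ℕ) : ℝ)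
    with hE
  have hFψ : ∀ σ, ∀ k ∈ F σ, momentumNumber k σ *ᵥ ψ = ψ := by
    intro σ k hk
    rw [hF, Finset.mem_filter] at hk
    exact (free_groundState_seaStructure hL hψ σ k).1 hk.2
  have hEψ : ∀ σ, ∀ k ∈ E σ, momentumNumber k σ *ᵥ ψ = 0 := by
    intro σ k hk
    rw [hE, Finset.mem_filter] at hk
    exact (free_groundState_seaStructure hL hψ σ k).2 hk.2
  -- the `↑`-shell has at most `2L` points
  have hshell : ((((F 0 ∪ E 0)ᶜ).card : ℕ) : ℝ) ≤ 2 * L := by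
    have hset : (F 0 ∪ E 0)ᶜ = Finset.univ.filter fun k : TorusSite 2 L =>
        ¬ ((((Finset.univ.filter fun k' : TorusSite 2 L => torusBand L k' ≤ torusBand L k).card : ℕ) : ℝ) ≤ ν 0) ∧
        ¬ (ν 0 ≤ (((Finset.univ.filter fun k' : TorusSite 2 L => torusBand L k' < torusBand L k).card : ℕ) : ℝ)) := by
      ext k
      simp only [hF, hE, Finset.mem_compl, Finset.mem_union, Finset.mem_filter, Finset.mem_univ, true_and, not_or]
    rw [hset]
    exact free_shell_card_le (ν 0)
  -- the coefficient profile of `Δ_d(m)`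
  set A : TorusSite 2 L → ℂ := fun k => ∑ e ∈ insert 0 unitSteps, ((dWaveFormFactor e / Real.sqrt 2 : ℝ) : ℂ) *
      (torusChar (m - k) (Torus.proj L e) + torusChar k (Torus.proj L e)) with hA
  have hA50 : ∀ k, ‖A k‖ ^ 2 ≤ 50 := fun k => by
    rw [← Complex.normSq_eq_norm_sq]
    exact normSq_pairModeAtCoeff_dWave_le m k
  have hΔ : pairFieldAt dWaveFormFactor L m =
      -∑ k : TorusSite 2 L, A k • (momentumAnnihilation (m - k) 1 * momentumAnnihilation k 0) :=
    pairFieldAt_eq_neg_sum_smul_pairModeAt dWaveFormFactor m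
  rw [hΔ, neg_mulVec, eucNorm_neg]
  calc eucNorm ((∑ k : TorusSite 2 L, A k • (momentumAnnihilation (m - k) 1 * momentumAnnihilation k 0)) *ᵥ ψ)
      ≤ Real.sqrt 50 * ((L : ℝ) + 2 * L) * eucNorm ψ :=
        free_eucNorm_modeSum_mulVec_le m A (by norm_num) hA50 F E ψ hFψ hEψ hshell
    _ = Real.sqrt 50 * (3 * L) * eucNorm ψ := by ring

/-- **Flat pair structure factor at the free point, every ground state**: `S_ψ(m) ≤ 450` for every
normalised sector ground state `ψ` of `hubbardTorus 2 L 1 0` (`L ≥ 3`), every `(N, S^z)` and every momentum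
label `m` (`S = pairStructureFactor dWaveFormFactor`). Bardeen–Cooper–Schrieffer (1957) §II. [folklore] -/
theorem free_pairStructureFactor_le (hL : 3 ≤ L) {N : ℕ} {M : ℝ} {ψ : Fock (Orb (FermionTorus 2 L))}
    (hψ : IsGroundStateInSector (hubbardTorus 2 L 1 0) N M ψ) (hψ1 : star ψ ⬝ᵥ ψ = 1)
    (m : TorusSite 2 L) : pairStructureFactor dWaveFormFactor L ψ m ≤ 450 := by
  have hLpos : (0 : ℝ) < L := Nat.cast_pos.2 (Nat.pos_of_ne_zero (NeZero.ne L))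
  have h := free_eucNorm_pairFieldAt_dWave_mulVec_le hL hψ m
  rw [eucNorm_eq_one hψ1, mul_one] at h
  have h2 : eucNorm (pairFieldAt dWaveFormFactor L m *ᵥ ψ) ^ 2 ≤ (Real.sqrt 50 * (3 * L)) ^ 2 :=
    pow_le_pow_left₀ (eucNorm_nonneg _) h 2
  rw [mul_pow, Real.sq_sqrt (by norm_num), eucNorm_sq] at h2
  rw [pairStructureFactor_apply, div_le_iff₀ (by positivity)]
  nlinarith [h2]

end PairField

/-! ## §5 The crux's window functional at the free point -/

section Window

variable {L : ℕ} [NeZero L]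

open Summit.HubbardSuperconductivity.HubbardSuperconductivity.Theorems.WindowGap.Negative (card_window_le)
open Summit.HubbardSuperconductivity.HubbardSuperconductivity.Theorems.WindowInfraredBound.Negative
  (one_le_sum_valMinAbs_sq)

/-- The window tail of a free sector ground state is at most `450 · #{m : |q_m| ≤ ε}`. [folklore] -/
theorem free_windowSum_le_card (hL : 3 ≤ L) {N : ℕ} {M : ℝ} {ψ : Fock (Orb (FermionTorus 2 L))}
    (hψ : IsGroundStateInSector (hubbardTorus 2 L 1 0) N M ψ) (hψ1 : star ψ ⬝ᵥ ψ = 1) (ε : ℝ) :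
    (∑ m : TorusSite 2 L, if m ≠ 0 ∧ momentumNormSq L m ≤ ε ^ 2 then
        pairStructureFactor dWaveFormFactor L ψ m else 0) ≤
      450 * ((Finset.univ.filter fun m : TorusSite 2 L => momentumNormSq L m ≤ ε ^ 2).card : ℝ) := by
  classical
  calc (∑ m : TorusSite 2 L, if m ≠ 0 ∧ momentumNormSq L m ≤ ε ^ 2 then
        pairStructureFactor dWaveFormFactor L ψ m else 0)
      ≤ ∑ m : TorusSite 2 L, if momentumNormSq L m ≤ ε ^ 2 then (450 : ℝ) else 0 := by
        refine Finset.sum_le_sum fun m _ => ?_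
        by_cases h1 : m ≠ 0 ∧ momentumNormSq L m ≤ ε ^ 2
        · rw [if_pos h1, if_pos h1.2]
          exact free_pairStructureFactor_le hL hψ hψ1 m
        · rw [if_neg h1]
          split_ifs <;> norm_num
    _ = 450 * ((Finset.univ.filter fun m : TorusSite 2 L => momentumNormSq L m ≤ ε ^ 2).card : ℝ) := by
        rw [Finset.sum_ite, Finset.sum_const_zero, add_zero, Finset.sum_const, nsmul_eq_mul, mul_comm]

/-- **The window infrared bound at the free point, FLAT law, every sector, every ground state.**
For `L ≥ 3`, every `(N, S^z = M)`, every normalised ground state `ψ` of `hubbardTorus 2 L 1 0` in that sector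
(the free sector ground spaces are degenerate — open shells — and `ψ` is ANY vector in them) and every `ε > 0`:
`T_ε(ψ) = Σ_{m ≠ 0, |q_m| ≤ ε} S_ψ(m) ≤ 113 · ε² · L²`
(`free_windowSum_le_card`; the window is empty below `ε < 2π/L` and has `≤ (2⌊εL/2π⌋+1)² ≤ 9(εL/2π)²` points
above, `card_window_le`; `450 · 9/(4π²) < 113`). This is the crux's window functional with the crux's rate
`C ε L²` improved to the metallic `C ε² L²`, uniformly in the filling. Bardeen–Cooper–Schrieffer (1957) §II;
Yang, Rev. Mod. Phys. 34 (1962) 694, §3. [folklore] -/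
theorem windowInfraredBound_free_allGroundStates (hL : 3 ≤ L) {N : ℕ} {M : ℝ}
    {ψ : Fock (Orb (FermionTorus 2 L))} (hψ : IsGroundStateInSector (hubbardTorus 2 L 1 0) N M ψ)
    (hψ1 : star ψ ⬝ᵥ ψ = 1) {ε : ℝ} (hε : 0 < ε) :
    (∑ m : TorusSite 2 L, if m ≠ 0 ∧ momentumNormSq L m ≤ ε ^ 2 then
        pairStructureFactor dWaveFormFactor L ψ m else 0) ≤ 113 * ε ^ 2 * (L : ℝ) ^ 2 := by
  classical
  have hLpos : (0 : ℝ) < L := Nat.cast_pos.2 (Nat.pos_of_ne_zero (NeZero.ne L))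
  have hπ : (3 : ℝ) < Real.pi := Real.pi_gt_three
  set J : ℕ := ⌊ε * L / (2 * Real.pi)⌋₊ with hJ
  rcases Nat.eq_zero_or_pos J with hJ0 | hJpos
  · -- empty window: `εL/2π < 1`
    have hlt : ε * L / (2 * Real.pi) < 1 := by
      have := Nat.lt_floor_add_one (ε * L / (2 * Real.pi))
      rw [← hJ, hJ0] at this
      simpa using this
    have hε2 : ε ^ 2 < (2 * Real.pi / (L : ℝ)) ^ 2 := by
      have h1 : ε < 2 * Real.pi / L := by
        rw [lt_div_iff₀ hLpos]
        rw [div_lt_one (by positivity)] at hlt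
        exact hlt
      exact pow_lt_pow_left₀ h1 hε.le two_ne_zero
    have h0 : (∑ m : TorusSite 2 L, if m ≠ 0 ∧ momentumNormSq L m ≤ ε ^ 2 then
        pairStructureFactor dWaveFormFactor L ψ m else 0) = 0 := by
      refine Finset.sum_eq_zero fun m _ => ?_
      rw [if_neg]
      rintro ⟨hm, hle⟩
      have h1 := one_le_sum_valMinAbs_sq L hm
      rw [momentumNormSq_apply] at hle
      have : (2 * Real.pi / (L : ℝ)) ^ 2 ≤ ε ^ 2 :=
        le_trans (by nlinarith [sq_nonneg (2 * Real.pi / (L : ℝ))]) hle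
      linarith
    rw [h0]; positivity
  · -- `J ≥ 1`: `#window ≤ (2J+1)² ≤ 9J² ≤ 9(εL/2π)²`
    have hcard := card_window_le (L := L) hε.le
    have hJle : (J : ℝ) ≤ ε * L / (2 * Real.pi) := Nat.floor_le (by positivity)
    have hJ1 : (1 : ℝ) ≤ J := by exact_mod_cast hJpos
    have hwin : (((Finset.univ.filter fun m : TorusSite 2 L => momentumNormSq L m ≤ ε ^ 2).card : ℕ) : ℝ) ≤
        (2 * J + 1 : ℝ) ^ 2 := by
      have : (Finset.univ.filter fun m : TorusSite 2 L => momentumNormSq L m ≤ ε ^ 2) =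
          (Finset.univ.filter fun m : Fin 2 → ZMod L =>
            (2 * Real.pi / (L : ℝ)) ^ 2 * (∑ i : Fin 2, (((m i).valMinAbs : ℤ) : ℝ) ^ 2) ≤ ε ^ 2) := rfl
      rw [this]
      exact_mod_cast hcard
    refine (free_windowSum_le_card hL hψ hψ1 ε).trans ?_
    have h9 : (2 * J + 1 : ℝ) ^ 2 ≤ 9 * (ε * L / (2 * Real.pi)) ^ 2 := by nlinarith
    have hx : 0 ≤ ε ^ 2 * (L : ℝ) ^ 2 := by positivity
    -- `(εL/2π)² · 4π² = ε² L²` and `4π² > 36`, so `450 · 9 (εL/2π)² ≤ 4050 ε²L²/36 ≤ 113 ε² L²`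
    have hsq : (ε * L / (2 * Real.pi)) ^ 2 * (4 * Real.pi ^ 2) = ε ^ 2 * (L : ℝ) ^ 2 := by
      field_simp
      ring
    have h36 : (36 : ℝ) ≤ 4 * Real.pi ^ 2 := by nlinarith
    have hkey : 450 * (9 * (ε * L / (2 * Real.pi)) ^ 2) ≤ 113 * ε ^ 2 * (L : ℝ) ^ 2 := by
      have hy : 0 ≤ (ε * L / (2 * Real.pi)) ^ 2 := sq_nonneg _
      nlinarith [mul_le_mul_of_nonneg_left h36 hy]
    nlinarith [hwin, h9, hkey]

/-- **The crux body at the free point is TRUE — for every filling and every ground state.** This is the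
statement `Theses.FunctionFieldCertificate.WindowInfraredBound` with its leading `∀ U : ℝ, 0 < U →` replaced
by `U := 0` and the restriction `δ ∈ (0, 1/2)` dropped (the `let D`, the sector, the window and the functional
are the crux's, verbatim): witnesses `C = 113`, `ε₀ = 1`, `L₀ = 3` (`windowInfraredBound_free_allGroundStates`,
`ε² ≤ ε` on `(0, 1]`). So the hypothesis `0 < U` of the crux is idle at the free point (contrast:
`WindowGap.Negative.not_windowGapAt_zero` — the sibling crux `WindowGap` is FALSE there), and the free anchor of
`Disproof.lean` §4.3 holds over the whole degenerate Slater ground space, not only along one Slater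
determinant. Bardeen–Cooper–Schrieffer (1957) §II; Yang, Rev. Mod. Phys. 34 (1962) 694, §3. [folklore] -/
theorem windowInfraredBoundBody_at_zero : ∀ δ : ℝ, ∃ C ε₀ : ℝ, 0 ≤ C ∧ 0 < ε₀ ∧ ∃ L₀ : ℕ,
    ∀ ε ∈ Set.Ioc (0:ℝ) ε₀, ∀ (L : ℕ) [NeZero L], L₀ ≤ L → Even L →
    let D : (Fin 2 → ZMod L) → Matrix (Finset (Literature.MathematicalPhysics.QuantumLattice.Orb
      (Literature.MathematicalPhysics.QuantumLattice.FermionTorus 2 L)))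
      (Finset (Literature.MathematicalPhysics.QuantumLattice.Orb
        (Literature.MathematicalPhysics.QuantumLattice.FermionTorus 2 L))) ℂ :=
      fun m => ∑ x : Fin 2 → ZMod L, Complex.exp (-(2 * Real.pi * Complex.I *
        (((∑ i : Fin 2, m i * x i).val : ℕ) : ℂ) / (L : ℂ))) •
          Literature.MathematicalPhysics.QuantumLattice.localPair
            Literature.MathematicalPhysics.QuantumLattice.dWaveFormFactor L x;
    ∀ ψ : Literature.MathematicalPhysics.QuantumLattice.Fock (Literature.MathematicalPhysics.QuantumLattice.Orb
      (Literature.MathematicalPhysics.QuantumLattice.FermionTorus 2 L)), star ψ ⬝ᵥ ψ = 1 →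
      Literature.MathematicalPhysics.QuantumLattice.IsGroundStateInSector
        (Literature.MathematicalPhysics.QuantumLattice.hubbardTorus 2 L 1 0) (2 * ⌊(1 - δ) * (L : ℝ) ^ 2 / 2⌋₊) 0 ψ →
      (∑ m : Fin 2 → ZMod L, if m ≠ 0 ∧ (2 * Real.pi / (L : ℝ)) ^ 2 *
          (∑ i : Fin 2, (((m i).valMinAbs : ℤ) : ℝ) ^ 2) ≤ ε ^ 2 then
        (star (Matrix.mulVec (D m) ψ) ⬝ᵥ Matrix.mulVec (D m) ψ).re / (L : ℝ) ^ 2 else 0) ≤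
        C * ε * (L : ℝ) ^ 2 := by
  intro δ
  refine ⟨113, 1, by norm_num, one_pos, 3, ?_⟩
  intro ε hε L _ hL _ D ψ hψ1 hψ
  have h := windowInfraredBound_free_allGroundStates hL hψ hψ1 hε.1
  have hεε : 113 * ε ^ 2 * (L : ℝ) ^ 2 ≤ 113 * ε * (L : ℝ) ^ 2 := by
    have : ε ^ 2 ≤ ε := by nlinarith [hε.1, hε.2]
    have hL2 : (0 : ℝ) ≤ (L : ℝ) ^ 2 := by positivity
    nlinarith
  exact h.trans hεε

end Window

end Summit.HubbardSuperconductivity.HubbardSuperconductivity.Theorems.WindowInfraredBound
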